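import Literature.Algebra.Homology.GroupCohomologyCupProduct
import Literature.Algebra.Homology.HomogeneousCochainsPartialProd
import Literature.AlgebraicTopology.SingularHomology.TwistedPrism
import HarnessLib

/-!
# Graded commutativity of the cup product on group cohomology (Brown V (3.6))

Topic `Algebra/Homology`; namespace `Literature.Algebra.Homology`.  Definitions with bodies and
theorems; NO named fact, no `sorry`.  Sequel of `GroupCohomologyCupProduct` (the Alexander–Whitney cup
product `cupProduct h : Hᵖ(G, k) → H^q(G, k) → Hᵐ(G, k)` on Mathlib's
`groupCohomology (Rep.trivial k G k)`, trivial coefficients in a commutative ring `k`, arbitrary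
group `G`).  We prove K. S. Brown, *Cohomology of Groups*, V §3 (3.6)
[book:brown1982-cohomology-groups p0117]: "Commutativity: for any `u ∈ Hᵖ(G, M)`, `v ∈ H^q(G, N)`, we
have `uv = (−1)^{pq} t_*(vu)`", hence "`H*(G, k)` [is] a graded anti-commutative `k`-algebra":

  `cupProduct_comm : cupProduct h u v = (-1) ^ (p * q) • cupProduct h' v u`   (`u ∈ Hᵖ`, `v ∈ H^q`).

## The proof (Hatcher's proof of his Thm. 3.11, run on the bar construction)

Brown proves (3.6) with the signed flip `τ` of `F ⊗ F` and the uniqueness up to homotopy of diagonal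
approximations.  Mathlib has neither the tensor product of resolutions in `Rep k G` nor that
uniqueness in a usable form, so we DEVIATE (announced in the lane INBOX) and transport instead
A. Hatcher, *Algebraic Topology*, §3.2, proof of Thm. 3.11 — the reversal `ρ(σ) = εₙ σ̄`,
`εₙ = (−1)^{n(n+1)/2}`, and the twisted prism operator `P` with `∂P + P∂ = ρ − 𝟙` — from singular
simplices to Brown's free contractible simplicial `G`-complex `X` of I §5 Exercise 3 (a)
[p0028]: its `n`-simplices are the `(n+1)`-tuples `(g₀, …, gₙ)`, and its `G`-equivariant cochains
are Mathlib's inhomogeneous cochains through the bar notation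
`[g₁|⋯|gₙ] = (1, g₁, g₁g₂, …, g₁⋯gₙ)` [p0027] — Mathlib's `Fin.partialProd`.  Everything Hatcher's
computation uses is that simplices can be restricted FUNCTORIALLY along ARBITRARY vertex maps
`f : Fin (m+1) → Fin (n+1)` (not only monotone ones) and that faces, front and back faces are such
restrictions; for the tuples `(g₀, …, gₙ) ↦ (g_{f 0}, …, g_{f m})` this is plain, and in
inhomogeneous coordinates it is

  `nerveMap f x = ((x₀⋯x_{f(i)−1})⁻¹ (x₀⋯x_{f(i+1)−1}))ᵢ`,  `(nerveMap f x)ᵢ = (∏_{<f i} x)⁻¹ ∏_{<f (i+1)} x`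

(§1: `nerveMap_nerveMap` functoriality, `nerveMap_succAbove_zero/succ` = Mathlib's faces
`Fin.contractNth` via `Fin.partialProd_contractNth`, `frontWord_eq_nerveMap`, `backWord_eq_nerveMap`,
`nerveMap_rev_apply : nerveMap rev x = (x_{n}⁻¹, …, x₁⁻¹)`).  The double-sum cancellation behind
`∂P + P∂ = ρ − 𝟙` is NOT redone: it is the tree's generic identity
`Literature.AlgebraicTopology.SingularHomology.TwistedPrism.sum_eq_mul` (valid for any function of
vertex maps), applied to `F(f) = w(nerveMap f x)` exactly as in the singular file
`Literature/AlgebraicTopology/SingularHomology/CupProductProofs.lean`, whose architecture §2–§3 copy.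

## Contents

* §1 `nerveMap` and its calculus; `d_eq_sum_nerveMap`:
  `(δf)(x) = Σₐ (−1)ᵃ f(nerveMap (Fin.succAbove a) x)` (Mathlib's coboundary as the simplicial one).
* §2 `rhoCochain n = ρ♯` (`(ρ♯u)(x₁, …, xₙ) = εₙ u(xₙ⁻¹, …, x₁⁻¹)`), `prismCochain n = P♯`,
  `d_rhoCochain` (`δρ♯ = ρ♯δ`), `prismCochain_d_add_d_prismCochain` (`P♯δ + δP♯ = ρ♯ − 𝟙`),
  `π_rhoCocycle` (`ρ^* = 𝟙` on `Hⁿ(G, k)`).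
* §3 `cupCochain_rhoCochain` (`ρ♯u ∪ ρ♯v = (−1)^{pq} ρ♯(v ∪ u)`), **`cupProduct_comm`** (Brown (3.6)),
  `cupProduct_comm_of_even`, `cupProduct_self_add_self_of_odd` (`2 u² = 0` for `deg u` odd),
  `cupProduct_self_eq_zero_of_odd` (`u² = 0` for `deg u` odd when `2 ∈ kˣ`).

Not here: non-trivial coefficients `M ⊗ N` and the twist `t_*` (the tree's cup product is for trivial
coefficients only).
-- TODO(general form): Brown (3.6) with coefficients `M ⊗ N → N ⊗ M`.

## References

* K. S. Brown, *Cohomology of Groups*, GTM 87, Springer (1982), V §3 (3.6) and the paragraph after it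
  (graded anti-commutativity of `H*(G, k)`); I §5 (bar notation, (5.2) the faces `dᵢ`; Exercise 3 (a):
  the simplicial complex `X` with simplices `(g₀, …, gₙ)`). [Brown1982CohomologyGroups] — held copy
  `book:brown1982-cohomology-groups`, chunks p0117, p0027, p0028.
* A. Hatcher, *Algebraic Topology*, CUP (2002), §3.2, Theorem 3.11 and its proof (`ρ`, `P`,
  `∂P + P∂ = ρ − 𝟙`, `εₙ₊₁ = (−1)ⁿ⁺¹εₙ`, `ε_{p+q} = (−1)^{pq} ε_p ε_q`). [Hatcher2002]
-/

noncomputable section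

open CategoryTheory groupCohomology
open Literature.AlgebraicTopology.SingularHomology (revSign revSign_zero revSign_succ revSign_mul_revSign
  neg_one_pow_congr)
open Literature.AlgebraicTopology.SingularHomology.TwistedPrism (prismMap)

universe u

namespace Literature.Algebra.Homology

variable {k G : Type u} [CommRing k]

/-! ### §1 Restriction of inhomogeneous words along arbitrary vertex maps -/

section Nerve

variable [Group G] {n m l p q : ℕ}

/-- **Restriction of a word along a vertex map.**  An inhomogeneous word `x = (x₀, …, x_{n−1}) ∈ Gⁿ`
is the simplex `(1, x₀, x₀x₁, …, x₀⋯x_{n−1})` of Brown's complex `X` (bar notation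
`[x₀|⋯|x_{n−1}]`, Mathlib `Fin.partialProd x`), with vertices `Fin (n + 1)`; its restriction along an
ARBITRARY map of vertices `f : Fin (m + 1) → Fin (n + 1)` is the tuple `(∏_{<f 0} x, …, ∏_{<f m} x)`,
i.e. in inhomogeneous coordinates the word with letters `(∏_{<f i} x)⁻¹ · ∏_{<f (i+1)} x`.  For
monotone `f` these are the simplicial operators of the nerve of `G` (faces: `nerveMap_succAbove_succ`);
for `f = Fin.rev` it is `(x_{n−1}⁻¹, …, x₀⁻¹)` (`nerveMap_rev_apply`).
[cite: Brown1982CohomologyGroups, I §5 (bar notation) and Exercise 3 (a)] -/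
def nerveMap (f : Fin (m + 1) → Fin (n + 1)) (x : Fin n → G) : Fin m → G :=
  fun i => (Fin.partialProd x (f i.castSucc))⁻¹ * Fin.partialProd x (f i.succ)

/-- The letters of `nerveMap f x`. [cite: Brown1982CohomologyGroups, I §5 (bar notation)] -/
@[simp]
theorem nerveMap_apply (f : Fin (m + 1) → Fin (n + 1)) (x : Fin n → G) (i : Fin m) :
    nerveMap f x i = (Fin.partialProd x (f i.castSucc))⁻¹ * Fin.partialProd x (f i.succ) :=
  rfl

/-- The homogeneous coordinates of the restricted word: `∏_{<a} (nerveMap f x) = (∏_{<f 0} x)⁻¹ ∏_{<f a} x`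
(the tuple `(g_{f 0}, …, g_{f m})` normalised to start with `1`).
[cite: Brown1982CohomologyGroups, I §5 (bar notation)] -/
theorem partialProd_nerveMap (f : Fin (m + 1) → Fin (n + 1)) (x : Fin n → G) (a : Fin (m + 1)) :
    Fin.partialProd (nerveMap f x) a = (Fin.partialProd x (f 0))⁻¹ * Fin.partialProd x (f a) := by
  induction a using Fin.induction with
  | zero => rw [Fin.partialProd_zero, inv_mul_cancel]
  | succ a ih => rw [Fin.partialProd_succ, ih, nerveMap_apply, mul_assoc, mul_inv_cancel_left]

/-- **Functoriality of restriction**: restricting along `f` and then along `f'` is restricting along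
`f ∘ f'` (for the tuples `(g₀, …, gₙ) ↦ (g_{f 0}, …, g_{f m})` this is composition of maps).
[cite: Brown1982CohomologyGroups, I §5 Exercise 3 (a)] -/
@[simp]
theorem nerveMap_nerveMap (f : Fin (m + 1) → Fin (n + 1)) (f' : Fin (l + 1) → Fin (m + 1))
    (x : Fin n → G) : nerveMap f' (nerveMap f x) = nerveMap (f ∘ f') x := by
  funext i
  simp only [nerveMap_apply, partialProd_nerveMap, Function.comp_apply, mul_inv_rev, inv_inv]
  rw [mul_assoc, mul_inv_cancel_left]

/-- Restriction along the identity is the identity. [cite: Brown1982CohomologyGroups, I §5 (bar notation)] -/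
@[simp]
theorem nerveMap_id (x : Fin n → G) : nerveMap id x = x :=
  funext fun i => Fin.partialProd_right_inv x i

/-- A letter between two consecutive vertices `a`, `a + 1` is the original letter `x_a` (plumbing for
`Fin.partialProd_right_inv` along casts of `Fin`). [folklore] -/
private theorem inv_partialProd_mul_partialProd_eq (x : Fin n → G) (a b : Fin (n + 1)) (c : Fin n)
    (ha : (a : ℕ) = c) (hb : (b : ℕ) = c + 1) :
    (Fin.partialProd x a)⁻¹ * Fin.partialProd x b = x c := by
  obtain rfl : a = c.castSucc := Fin.ext ha
  obtain rfl : b = c.succ := Fin.ext (by rw [hb, Fin.val_succ])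
  exact Fin.partialProd_right_inv x c

/-- **The zeroth face** `d₀[x₀|⋯|xₙ] = [x₁|⋯|xₙ]` (Brown (5.2), `i = 0`; the factor `x₀` acts trivially
on trivial coefficients) is restriction along `Fin.succAbove 0`.
[cite: Brown1982CohomologyGroups, I §5 (5.2)] -/
theorem nerveMap_succAbove_zero (x : Fin (n + 1) → G) :
    nerveMap (Fin.succAbove (0 : Fin (n + 2))) x = fun i => x i.succ := by
  funext i
  rw [nerveMap_apply, partialProd_succAbove_zero, partialProd_succAbove_zero, mul_inv_rev, mul_assoc,
    inv_mul_cancel_left, Fin.partialProd_right_inv]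

/-- **The inner and last faces** `d_{j+1}[x₀|⋯|xₙ] = [x₀|⋯|xⱼxⱼ₊₁|⋯|xₙ]`, `d_{n+1}[x₀|⋯|xₙ] = [x₀|⋯|xₙ₋₁]`
(Brown (5.2); Mathlib's `Fin.contractNth j (· * ·)`) are restriction along `Fin.succAbove j.succ`
(Mathlib `Fin.partialProd_contractNth`). [cite: Brown1982CohomologyGroups, I §5 (5.2)] -/
theorem nerveMap_succAbove_succ (x : Fin (n + 1) → G) (j : Fin (n + 1)) :
    nerveMap (Fin.succAbove j.succ) x = Fin.contractNth j (· * ·) x := by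
  funext i
  rw [nerveMap_apply, partialProd_succAbove_succ, partialProd_succAbove_succ, Fin.partialProd_right_inv]

/-- **Mathlib's coboundary is the simplicial coboundary**: with trivial coefficients,
`(δf)(x) = Σ_{a ≤ n+1} (−1)ᵃ f(nerveMap (Fin.succAbove a) x)`, the alternating sum over the faces of
Brown (5.2). [cite: Brown1982CohomologyGroups, I §5 (5.2) and III §1 Example 3] -/
theorem d_eq_sum_nerveMap (f : (Fin n → G) → k) (x : Fin (n + 1) → G) :
    inhomogeneousCochains.d (Rep.trivial k G k) n f x =
      ∑ a : Fin (n + 2), (-1 : k) ^ (a : ℕ) * f (nerveMap (Fin.succAbove a) x) := by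
  rw [Fin.sum_univ_succ, inhomogeneousCochains.d_hom_apply, Fin.val_zero, pow_zero, one_mul,
    nerveMap_succAbove_zero, Rep.trivial_ρ_apply]
  congr 1
  exact Finset.sum_congr rfl fun j _ => by rw [Fin.val_succ, nerveMap_succAbove_succ, smul_eq_mul]

/-- The vertex map `i ↦ i` of the front `p`-face (vertices `0, …, p` of `0, …, n`).
[cite: Brown1982CohomologyGroups, V §3 (Alexander–Whitney formula)] -/
def nerveFrontMap (p n : ℕ) (_h : p ≤ n) : Fin (p + 1) → Fin (n + 1) := fun i => ⟨i, by omega⟩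

/-- The vertex map `i ↦ i + (n − q)` of the back `q`-face (vertices `n − q, …, n` of `0, …, n`).
[cite: Brown1982CohomologyGroups, V §3 (Alexander–Whitney formula)] -/
def nerveBackMap (q n : ℕ) (_h : q ≤ n) : Fin (q + 1) → Fin (n + 1) := fun i => ⟨i + (n - q), by omega⟩

/-- The front word `(x₁, …, x_p)` of the Alexander–Whitney formula is restriction along the front
vertex map. [cite: Brown1982CohomologyGroups, V §3 (Alexander–Whitney formula)] -/
theorem frontWord_eq_nerveMap (h : p + q = n) (x : Fin n → G) :
    frontWord h x = nerveMap (nerveFrontMap p n (by omega)) x := by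
  funext i
  rw [frontWord_apply, nerveMap_apply]
  exact (inv_partialProd_mul_partialProd_eq x _ _ ⟨i, by omega⟩ rfl rfl).symm

/-- The back word `(x_{p+1}, …, x_{p+q})` of the Alexander–Whitney formula is restriction along the
back vertex map. [cite: Brown1982CohomologyGroups, V §3 (Alexander–Whitney formula)] -/
theorem backWord_eq_nerveMap (h : p + q = n) (x : Fin n → G) :
    backWord h x = nerveMap (nerveBackMap q n (by omega)) x := by
  funext j
  rw [backWord_apply, nerveMap_apply]
  exact (inv_partialProd_mul_partialProd_eq x _ _ ⟨p + j, by omega⟩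
    (by simp only [nerveBackMap, Fin.val_castSucc]; omega)
    (by simp only [nerveBackMap, Fin.val_succ]; omega)).symm

/-- Reversal carries the front `p`-face to the reversed back `p`-face:
`rev ∘ front_p = back_p ∘ rev` (Hatcher's displayed formulas for `ρ^*φ ⌣ ρ^*ψ` and `ρ^*(ψ ⌣ φ)`).
[cite: Hatcher2002, §3.2 proof of Thm. 3.11] -/
theorem rev_comp_nerveFrontMap (h : p ≤ n) :
    Fin.rev ∘ nerveFrontMap p n h = nerveBackMap p n h ∘ Fin.rev := by
  funext i
  apply Fin.ext
  simp only [Function.comp_apply, Fin.val_rev, nerveFrontMap, nerveBackMap]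
  omega

/-- Reversal carries the back `q`-face to the reversed front `q`-face: `rev ∘ back_q = front_q ∘ rev`.
[cite: Hatcher2002, §3.2 proof of Thm. 3.11] -/
theorem rev_comp_nerveBackMap (h : q ≤ n) :
    Fin.rev ∘ nerveBackMap q n h = nerveFrontMap q n h ∘ Fin.rev := by
  funext i
  apply Fin.ext
  simp only [Function.comp_apply, Fin.val_rev, nerveFrontMap, nerveBackMap]
  omega

/-- **Restriction along the reversal of the vertices inverts and reverses the word**:
`nerveMap rev (x₀, …, x_{n−1}) = (x_{n−1}⁻¹, …, x₀⁻¹)` (the simplex `(1, x₀, …, x₀⋯x_{n−1})` read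
backwards and renormalised). [cite: Brown1982CohomologyGroups, I §5 (bar notation)] -/
theorem nerveMap_rev_apply (x : Fin n → G) (i : Fin n) :
    nerveMap Fin.rev x i = (x (Fin.rev i))⁻¹ := by
  rw [nerveMap_apply, Fin.rev_castSucc, Fin.rev_succ, Fin.partialProd_succ, mul_inv_rev,
    inv_mul_cancel_right]

end Nerve

/-! ### §2 The reversal `ρ♯` and the twisted prism operator `P♯` on inhomogeneous cochains -/

section Reversal

variable [Group G] {n m p q : ℕ}

/-- **Hatcher's reversal on cochains**, transported to `Cⁿ(G, k)`:
`(ρ♯u)(x) = εₙ u(nerveMap rev x) = εₙ u(xₙ⁻¹, …, x₁⁻¹)`, `εₙ = (−1)^{n(n+1)/2}` (the tree's `revSign`);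
the dual of the `G`-equivariant chain map `(g₀, …, gₙ) ↦ εₙ (gₙ, …, g₀)` of the bar resolution.
[cite: Hatcher2002, §3.2 proof of Thm. 3.11] -/
def rhoCochain (n : ℕ) : ((Fin n → G) → k) →ₗ[k] ((Fin n → G) → k) where
  toFun u x := revSign k n * u (nerveMap Fin.rev x)
  map_add' u v := funext fun x => by simp [mul_add]
  map_smul' r u := funext fun x => by simp [mul_left_comm]

/-- `(ρ♯u)(x) = εₙ u(nerveMap rev x)`. [cite: Hatcher2002, §3.2 proof of Thm. 3.11] -/
@[simp]
theorem rhoCochain_apply (u : (Fin n → G) → k) (x : Fin n → G) :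
    rhoCochain n u x = revSign k n * u (nerveMap Fin.rev x) :=
  rfl

/-- `(ρ♯u)(x₁, …, xₙ) = εₙ u(xₙ⁻¹, …, x₁⁻¹)` written out. [cite: Hatcher2002, §3.2 proof of Thm. 3.11] -/
theorem rhoCochain_apply' (u : (Fin n → G) → k) (x : Fin n → G) :
    rhoCochain n u x = revSign k n * u (fun i => (x (Fin.rev i))⁻¹) := by
  rw [rhoCochain_apply]
  exact congrArg (fun y => revSign k n * u y) (funext (nerveMap_rev_apply x))

/-- **The dual `P♯ : Cⁿ⁺¹(G, k) → Cⁿ(G, k)` of Hatcher's twisted prism operator**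
`P(σ) = Σᵢ (−1)ⁱ εₙ₋ᵢ σ|[v₀, …, vᵢ, vₙ, …, vᵢ]`: `(P♯w)(x) = Σᵢ (−1)ⁱ εₙ₋ᵢ w(nerveMap (prismMap n i) x)`
(the tree's vertex maps `TwistedPrism.prismMap`). [cite: Hatcher2002, §3.2 proof of Thm. 3.11] -/
def prismCochain (n : ℕ) : ((Fin (n + 1) → G) → k) →ₗ[k] ((Fin n → G) → k) where
  toFun w x := ∑ i : Fin (n + 1),
    ((-1 : k) ^ (i : ℕ) * revSign k (n - i)) * w (nerveMap (prismMap n i) x)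
  map_add' w w' := funext fun x => by simp [Finset.sum_add_distrib, mul_add]
  map_smul' r w := funext fun x => by simp [Finset.mul_sum, mul_left_comm]

/-- The formula for `P♯`. [cite: Hatcher2002, §3.2 proof of Thm. 3.11] -/
@[simp]
theorem prismCochain_apply (w : (Fin (n + 1) → G) → k) (x : Fin n → G) :
    prismCochain n w x = ∑ i : Fin (n + 1),
      ((-1 : k) ^ (i : ℕ) * revSign k (n - i)) * w (nerveMap (prismMap n i) x) :=
  rfl

/-- **`ρ♯` is a cochain map: `δρ♯ = ρ♯δ`** (the faces of the reversed simplex are the reversed faces in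
the opposite order, `Fin.rev_succAbove`, and `εₙ₊₁ = (−1)ⁿ⁺¹ εₙ`).
[cite: Hatcher2002, §3.2 proof of Thm. 3.11] -/
theorem d_rhoCochain (u : (Fin n → G) → k) :
    inhomogeneousCochains.d (Rep.trivial k G k) n (rhoCochain n u) =
      rhoCochain (n + 1) (inhomogeneousCochains.d (Rep.trivial k G k) n u) := by
  funext x
  rw [rhoCochain_apply, d_eq_sum_nerveMap, d_eq_sum_nerveMap, Finset.mul_sum]
  simp only [rhoCochain_apply, nerveMap_nerveMap]
  rw [← Equiv.sum_comp Fin.revPerm]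
  refine Finset.sum_congr rfl fun i _ => ?_
  have e : Fin.succAbove (Fin.revPerm i) ∘ Fin.rev = Fin.rev ∘ Fin.succAbove i := by
    funext y
    simp [Fin.rev_succAbove]
  have hi : (i : ℕ) < n + 2 := i.isLt
  have hs : (-1 : k) ^ (n + 1 + 1 - ((i : ℕ) + 1)) = (-1 : k) ^ (n + 1) * (-1 : k) ^ (i : ℕ) := by
    rw [← pow_add]
    exact neg_one_pow_congr k (by omega)
  rw [e, Fin.revPerm_apply, Fin.val_rev, revSign_succ, hs]
  ring

/-- **The chain homotopy `P♯δ + δP♯ = ρ♯ − 𝟙`** on `Cᵐ⁺¹(G, k)`, evaluated at a word `x`: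
`(P♯δw)(x) + (δP♯w)(x) = εₘ₊₁ w(nerveMap rev x) − w(x)`.  Expanding the left-hand side with the
functoriality of `nerveMap` gives EXACTLY the tree's twisted prism identity `TwistedPrism.sum_eq_mul`
for `F(f) = w(nerveMap f x)` (Hatcher's cancellation of double sums, not redone here).
[cite: Hatcher2002, §3.2 proof of Thm. 3.11] -/
theorem prismCochain_d_add_d_prismCochain (w : (Fin (m + 1) → G) → k) (x : Fin (m + 1) → G) :
    prismCochain (m + 1) (inhomogeneousCochains.d (Rep.trivial k G k) (m + 1) w) x +
      inhomogeneousCochains.d (Rep.trivial k G k) m (prismCochain m w) x =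
      revSign k (m + 1) * w (nerveMap Fin.rev x) - w x := by
  have h₁ : ∀ i : Fin (m + 2),
      inhomogeneousCochains.d (Rep.trivial k G k) (m + 1) w (nerveMap (prismMap (m + 1) i) x) =
        ∑ j : Fin (m + 3), (-1 : k) ^ (j : ℕ) * w (nerveMap (prismMap (m + 1) i ∘ Fin.succAbove j) x) :=
    fun i => by
      rw [d_eq_sum_nerveMap]
      exact Finset.sum_congr rfl fun j _ => by rw [nerveMap_nerveMap]
  rw [prismCochain_apply, d_eq_sum_nerveMap]
  simp only [h₁, prismCochain_apply, Finset.mul_sum, nerveMap_nerveMap]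
  have h := Literature.AlgebraicTopology.SingularHomology.TwistedPrism.sum_eq_mul k (m := m)
    (fun f => w (nerveMap f x))
  simp only [nerveMap_id] at h
  exact h

/-- In degree `0`, `ρ♯ = 𝟙` (`ε₀ = 1` and there is one empty word). [cite: Hatcher2002, §3.2 proof of Thm. 3.11] -/
theorem rhoCochain_zero (u : (Fin 0 → G) → k) : rhoCochain 0 u = u := by
  funext x
  rw [rhoCochain_apply, revSign_zero, one_mul]
  exact congrArg u (funext fun i => Fin.elim0 i)

/-- `ρ♯` of a cocycle is a cocycle. [cite: Hatcher2002, §3.2 proof of Thm. 3.11] -/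
theorem d_rhoCochain_iCocycles (a : cocycles (Rep.trivial k G k) n) :
    inhomogeneousCochains.d (Rep.trivial k G k) n (rhoCochain n (iCocycles (Rep.trivial k G k) n a)) = 0 := by
  rw [d_rhoCochain, d_iCocycles, map_zero]

/-- The cocycle `ρ♯a` for `a ∈ Zⁿ(G, k)`. [cite: Hatcher2002, §3.2 proof of Thm. 3.11] -/
def rhoCocycle (a : cocycles (Rep.trivial k G k) n) : cocycles (Rep.trivial k G k) n :=
  cocyclesMk (rhoCochain n (iCocycles (Rep.trivial k G k) n a)) (d_rhoCochain_iCocycles a)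

/-- The cochain of `ρ♯a` is `ρ♯` of the cochain of `a`. [cite: Hatcher2002, §3.2 proof of Thm. 3.11] -/
@[simp]
theorem iCocycles_rhoCocycle (a : cocycles (Rep.trivial k G k) n) :
    iCocycles (Rep.trivial k G k) n (rhoCocycle a) = rhoCochain n (iCocycles (Rep.trivial k G k) n a) :=
  iCocycles_mk _ (d_rhoCochain_iCocycles a)

/-- **`ρ^* = 𝟙` on `Hⁿ(G, k)`**: `[ρ♯a] = [a]`, since `ρ♯a − a = δ(P♯a)` for a cocycle `a` ("`ρ` is
chain homotopic to the identity").  In words: the class of `(x₁, …, xₙ) ↦ εₙ a(xₙ⁻¹, …, x₁⁻¹)` is the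
class of `a`. [cite: Hatcher2002, §3.2 proof of Thm. 3.11] -/
theorem π_rhoCocycle (a : cocycles (Rep.trivial k G k) n) :
    π (Rep.trivial k G k) n (rhoCocycle a) = π (Rep.trivial k G k) n a := by
  cases n with
  | zero =>
    congr 1
    exact iCocycles_injective _ 0 (by rw [iCocycles_rhoCocycle, rhoCochain_zero])
  | succ m =>
    refine (π_succ_eq_iff (Rep.trivial k G k) m _ _).2 ⟨prismCochain m (iCocycles (Rep.trivial k G k) (m + 1) a), ?_⟩
    funext x
    have h := prismCochain_d_add_d_prismCochain (iCocycles (Rep.trivial k G k) (m + 1) a) x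
    rw [d_iCocycles, map_zero, Pi.zero_apply, zero_add] at h
    rw [h, Pi.sub_apply, iCocycles_rhoCocycle, rhoCochain_apply]

end Reversal

/-! ### §3 Graded commutativity -/

section Commutativity

variable [Group G] {n p q : ℕ}

/-- **The cochain formula `ρ♯u ∪ ρ♯v = (−1)^{pq} ρ♯(v ∪ u)`** for `u ∈ Cᵖ(G, k)`, `v ∈ C^q(G, k)`,
`p + q = n = q + p`: the front `p`-face of the reversed word is the reversed back `p`-face,
`k` is commutative, and `ε_p ε_q = (−1)^{pq} ε_{p+q}`. [cite: Hatcher2002, §3.2 proof of Thm. 3.11] -/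
theorem cupCochain_rhoCochain (h : p + q = n) (h' : q + p = n) (u : (Fin p → G) → k)
    (v : (Fin q → G) → k) :
    cupCochain h (rhoCochain p u) (rhoCochain q v) =
      ((-1 : k) ^ (p * q)) • rhoCochain n (cupCochain h' v u) := by
  funext x
  simp only [cupCochain_apply, rhoCochain_apply, Pi.smul_apply, smul_eq_mul]
  rw [frontWord_eq_nerveMap h, backWord_eq_nerveMap h, frontWord_eq_nerveMap h',
    backWord_eq_nerveMap h']
  simp only [nerveMap_nerveMap, rev_comp_nerveFrontMap, rev_comp_nerveBackMap]
  subst h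
  rw [mul_mul_mul_comm, revSign_mul_revSign]
  ring

/-- **Graded (anti-)commutativity of the cup product on group cohomology** (Brown V (3.6), trivial
coefficients): `u ∪ v = (−1)^{pq} v ∪ u` for `u ∈ Hᵖ(G, k)`, `v ∈ H^q(G, k)`, any group `G`, any
commutative ring `k` ("`H*(G, k)` is a graded anti-commutative `k`-algebra").  Proof (Hatcher):
replace representing cocycles `a`, `b` by `ρ♯a`, `ρ♯b` (same classes, `π_rhoCocycle`), use
`ρ♯a ∪ ρ♯b = (−1)^{pq} ρ♯(b ∪ a)` and `[ρ♯(b ∪ a)] = [b ∪ a]`.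
[cite: Brown1982CohomologyGroups, V §3 (3.6)] -/
theorem cupProduct_comm (h : p + q = n) (h' : q + p = n) (u : groupCohomology (Rep.trivial k G k) p)
    (v : groupCohomology (Rep.trivial k G k) q) :
    cupProduct h u v = ((-1 : k) ^ (p * q)) • cupProduct h' v u := by
  induction u using groupCohomology_induction_on with
  | h a =>
  induction v using groupCohomology_induction_on with
  | h b =>
    conv_lhs => rw [← π_rhoCocycle a, ← π_rhoCocycle b, cupProduct_π_π]
    rw [cupProduct_π_π]
    have hc : cocyclesCup h (rhoCocycle a) (rhoCocycle b) =
        ((-1 : k) ^ (p * q)) • rhoCocycle (cocyclesCup h' b a) := by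
      apply iCocycles_injective (Rep.trivial k G k) n
      rw [iCocycles_cocyclesCup, iCocycles_rhoCocycle, iCocycles_rhoCocycle, map_smul,
        iCocycles_rhoCocycle, iCocycles_cocyclesCup]
      exact cupCochain_rhoCochain h h' _ _
    rw [hc, map_smul, π_rhoCocycle]

/-- Graded commutativity along a single equation of degrees: `u ∪ v = (−1)^{pq} v ∪ u` with the
right-hand product in degree `q + p` transported along `Nat.add_comm`. [cite: Brown1982CohomologyGroups, V §3 (3.6)] -/
theorem cupProduct_comm' (h : p + q = n) (u : groupCohomology (Rep.trivial k G k) p)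
    (v : groupCohomology (Rep.trivial k G k) q) :
    cupProduct h u v = ((-1 : k) ^ (p * q)) • cupProduct ((Nat.add_comm q p).trans h) v u :=
  cupProduct_comm h _ u v

/-- **Commutativity when one degree is even**: `u ∪ v = v ∪ u` if `p` or `q` is even.
[cite: Brown1982CohomologyGroups, V §3 (3.6)] -/
theorem cupProduct_comm_of_even (h : p + q = n) (h' : q + p = n) (hpq : Even p ∨ Even q)
    (u : groupCohomology (Rep.trivial k G k) p) (v : groupCohomology (Rep.trivial k G k) q) :
    cupProduct h u v = cupProduct h' v u := by
  have he : Even (p * q) := by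
    rcases hpq with hp | hq
    · exact hp.mul_right q
    · exact hq.mul_left p
  rw [cupProduct_comm h h', he.neg_one_pow, one_smul]

/-- **Squares of odd-degree classes are `2`-torsion**: `u ∪ u + u ∪ u = 0` for `u ∈ Hᵖ(G, k)`, `p` odd
(from `u ∪ u = (−1)^{p²} u ∪ u = −(u ∪ u)`; "anti-commutative").
[cite: Brown1982CohomologyGroups, V §3 (3.6)] -/
theorem cupProduct_self_add_self_of_odd (h : p + p = n) (hp : Odd p)
    (u : groupCohomology (Rep.trivial k G k) p) :
    cupProduct h u u + cupProduct h u u = 0 := by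
  have ho : Odd (p * p) := hp.mul hp
  have hc := cupProduct_comm h h u u
  rw [ho.neg_one_pow, neg_smul, one_smul] at hc
  exact eq_neg_iff_add_eq_zero.1 hc

/-- **`u ∪ u = 0` for `u` of odd degree when `2` is invertible in `k`.**
[cite: Brown1982CohomologyGroups, V §3 (3.6)] -/
theorem cupProduct_self_eq_zero_of_odd (h : p + p = n) (hp : Odd p) (h2 : IsUnit (2 : k))
    (u : groupCohomology (Rep.trivial k G k) p) : cupProduct h u u = 0 := by
  have h₂ : (2 : k) • cupProduct h u u = 0 := by
    rw [two_smul]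
    exact cupProduct_self_add_self_of_odd h hp u
  exact (h2.smul_eq_zero).1 h₂

end Commutativity

end Literature.Algebra.Homology

end
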